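import Mathlib
import HarnessLib
import Summits.HubbardSuperconductivity.HubbardSuperconductivity.Theorems.KLProgrammeKLRegimeEngineTwoLegStepSuccDoor
import Summits.HubbardSuperconductivity.HubbardSuperconductivity.Theorems.KLProgrammeKLRegimeSplitTwoLegCoreTDProfile
import Summits.HubbardSuperconductivity.HubbardSuperconductivity.Theorems.KLProgrammeKLRegimeTwoLegCurvatureDefs

/-!
# K3 ENGINE child `KLRegimeEngineV16` (stmt-HubbardSuperconductivity-20236, skeleton v3-α 9747d23d14535406), stub (e) `stub_twoLeg_step`:
# the assembly door at `n + 1` keyed on p1b's PROFILE data, and on the stub-6 predicate `TwoLegCurveJetBound` (plan g15 (R24) / (D4))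

Cell gate-hubbard-kl, seat hubbard-kl-r2d-p1 (g4); sequel of `…EngineTwoLegStepSuccDoor` (p517516; plan g15 START-HERE 2026-08-27T08:41:42Z, pen (D4)
«twin the (e)-door» 09:17:20Z).  The core conjunct `TwoLegCoreTD … (n+1)` is taken here from p1b's PROFILE-keyed closer
`KLRegimeSplit.twoLegCoreTD_succ_of_profileData_stub8` (…TwoLegCoreTDProfile, p517895): its (E3a) inputs are the ANGULAR JETS `A 0, A 1, A 2` of the
increment profile `δ_{n+1}(θ) = ν_{n+1}(K)(θ) − ν_n(K)(θ)` (no momentum derivative of any reading function — p2 g10's (D3) diagnosis of the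
tube-keyed `…_stub7`), its (E3c) inputs the NEAR profile response `ρ` and the FAR value size, its (E3e) inputs the shell field strength and the
shell-tube gradient of the K-separated reading.

* **`twoLegStepV16_succ_of_profileData_stub`** — under (e)'s literal binders: `TwoLegStepV16 … (n+1)` from (A) the inputs of `…_of_profileData_stub8`,
  (B) `TwoLegSizesMSTQ … (n+1)` by name, (C) the two nested-leg rates;
* **`twoLegStepV16_succ_of_curveJets_stub`** — the same with the three jets DISCHARGED from p2 g10's stub-6 predicate
  `KLRegimeSplit.TwoLegCurveJetBound L M cc cc' β U μ K (n+1)` (…TwoLegCurvatureDefs, p517656: `A k := curveJetBar cc cc' U k (n+1)`; the registered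
  form `TwoLegCurveJetBoundGQ … G Q` is the instance `cc := G.S`, `cc' := Q.S'`): what the v4 composition feeds stub (e) from `stub_twoLeg_curvature`.
  Residuals: the fit `hfitS` of those bars into `twoLegBar klEngGeo5 (klEngQ5 P R) U j (n+1)` (constants chosen by the registrant), the (E3c)/(E3e) rows,
  (B) by name, (C).

Proofs only (compositions of landed theorems); no definitions; nothing about the model is asserted.
References: BGM 2006 §2.4 (2.36) [cite: BenfattoGiulianiMastropietro2006]; KL STATUS l.2359 ((R24)), l.2378, l.2398 (p1b), l.2409 (p2).
-/

noncomputable section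

namespace Summit.HubbardSuperconductivity.HubbardSuperconductivity.Theorems.EngineV8

set_option linter.dupNamespace false -- summit = problem name (single-conjunct summit), D-0017

open Real Finset Literature.MathematicalPhysics.QuantumLattice Literature.Probability.LatticeModels
open Literature.MathematicalPhysics.QuantumLattice.FermiRG Literature.MathematicalPhysics.QuantumLattice.BandSectorCounting
open Summit.HubbardSuperconductivity.HubbardSuperconductivity.Theorems.KLProgrammeLegKernels
open Summit.HubbardSuperconductivity.HubbardSuperconductivity.Theorems.DispersionFlow
open Summit.HubbardSuperconductivity.HubbardSuperconductivity.Theorems.PerturbedFermiCurve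
open Summit.HubbardSuperconductivity.HubbardSuperconductivity.Theorems.KLRegimeSplit

/-! ## §1 The door keyed on p1b's profile data -/

/-- **THE ASSEMBLY DOOR OF `stub_twoLeg_step` AT SCALE `n + 1`, CORE OPENED ON PROFILE DATA** — under the stub's LITERAL binders, the slot
`TwoLegStepV16 L M klEngGeo5 P (klEngQ5 P R) R β U μ K (n+1)` from: (A) `hA0/hA1/hA2` — the angular jets of the increment profile
`θ ↦ ν_{n+1}(K)(θ) − ν_n(K)(θ)`, `hfitS` — their fit into `twoLegBar … j (n+1)` (j ≤ 2), `hd/hnear` — the NEAR (`frameDist K K′ ≤ d`) profile response `ρ`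
against degree-capped comparison frames carrying the history at `(L, M)`, `hvK'` — the value size of every such frame's own increment profile, `hfitL/hfar` —
the (E3c) fits, `hz/hm₁'/hfit1` — shell field strength, shell-tube gradient of `I_L[σ_{n+1} − K∘p]`, slopes fit (all = the inputs of p1b's
`twoLegCoreTD_succ_of_profileData_stub8`); (B) `hms` by name; (C) `hcut/hsp` — the two nested-leg rates (k3c4-p1's door). -/
theorem twoLegStepV16_succ_of_profileData_stub (P : SplitConsts) (R : RenConsts) (c : ℝ) (hP : P.WF) (hR : R.WF2) (hc : 0 < c)
    (hc3 : c ≤ klEngC₃3 P R) (μ : ℝ) (hμ : μ ∈ klWindowC) (U : ℝ) (hU : 0 < U) (hUle : U ≤ klEngU₀4 P R c) (β : ℝ) (hβ : klBetaMin ≤ β)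
    (hβc : β ≤ Real.exp (c / U ^ 2)) (K : TrigPolyC4v) (hK : FrameOKDeg R U (nScales β) μ K) (L M : ℕ) [NeZero L] [NeZero M]
    (hL : klEngL₃ β U ≤ L) (hM : klEngM₃ β U L ≤ M) (n : ℕ) (hn : n + 1 ≤ nScales β + 1) (hreg : IsKLRegime U c (-((n + 1 : ℕ) : ℤ)))
    (hhist : HistP klPredsV16 L M klEngGeo5 P (klEngQ5 P R) R β U μ K (n + 1))
    (hE : EngineBoundsAtV10S L M klEngGeo5 P (klEngQ5 P R) β U μ K (n + 1))
    -- (A) the profile-keyed inputs of the core at scale `n + 1`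
    {A : ℕ → ℝ}
    (hA0 : ∀ θ : ℝ, |klLocalPart L M β U μ K (n + 1) θ - klLocalPart L M β U μ K n θ| ≤ A 0)
    (hA1 : ∀ θ : ℝ, |deriv (fun θ => klLocalPart L M β U μ K (n + 1) θ - klLocalPart L M β U μ K n θ) θ| ≤ A 1)
    (hA2 : ∀ θ : ℝ, |iteratedDeriv 2 (fun θ => klLocalPart L M β U μ K (n + 1) θ - klLocalPart L M β U μ K n θ) θ| ≤ A 2)
    (hfitS : ∀ j ≤ 2, (if j = 0 then A 0 else 0) +
      (j.factorial : ℝ) ^ 2 * (2 * j.factorial * 1110 * 200 ^ j) *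
        (if j = 0 then 2 * A 0 else (2 * π + 1) * A 1 + (if j = 2 then A 2 else 0)) *
        (4 + max 1 (((j - 1).factorial : ℝ) / (8 / 5))) ^ j ≤ twoLegBar klEngGeo5 (klEngQ5 P R) U j (n + 1))
    {d ρ : ℝ} (hd : 0 < d)
    (hnear : ∀ K' : TrigPolyC4v, FrameOKDeg R U (klTempScaleIdx β klE0) μ K' →
      (∀ j < n + 1, histV15 L M klEngGeo5 P (klEngQ5 P R) R β U μ K' j) → frameDist K K' ≤ d → ∀ θ : ℝ,
      |(klLocalPart L M β U μ K (n + 1) θ - klLocalPart L M β U μ K n θ) -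
        (klLocalPart L M β U μ K' (n + 1) θ - klLocalPart L M β U μ K' n θ)| ≤ ρ * frameDist K K')
    (hvK' : ∀ K' : TrigPolyC4v, FrameOKDeg R U (klTempScaleIdx β klE0) μ K' →
      (∀ j < n + 1, histV15 L M klEngGeo5 P (klEngQ5 P R) R β U μ K' j) → ∀ θ : ℝ,
      |klLocalPart L M β U μ K' (n + 1) θ - klLocalPart L M β U μ K' n θ| ≤ A 0)
    (hfitL : ρ ≤ lipBar klEngGeo5 (klEngQ5 P R) U (n + 1)) (hfar : 2 * A 0 ≤ lipBar klEngGeo5 (klEngQ5 P R) U (n + 1) * d)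
    (hz : ∀ k ∈ klShell L μ K (n + 1), |klFieldStrength L M β U μ K (n + 1) k - 1| ≤ R.cz * |U|)
    {m₁' : ℝ}
    (hm₁' : ∀ q : Momentum, |frameLevel μ K q| ≤ klScale klE0 (n + 1) →
      ‖fderiv ℝ (evalM (symInterp L (fun p => klLocSelfEnergyRe L M β U μ K (n + 1) p - K.eval (latticeMomentum L p)))) q‖ ≤ m₁')
    (hfit1 : m₁' + 4 / 3 * R.Gfr 1 * U ^ 2 ≤ R.cz * |U| * (cDtmin (-1.2) (-0.05) / 2))
    -- (B) the multi-slot sizes at scale `n + 1`, by name (opened in `…TwoLegStepSuccDoorMS`)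
    (hms : TwoLegSizesMSTQ L M klEngGeo5 (klEngQ5 P R) R β U μ K (n + 1))

    -- (C) the two nested-leg rates at scale `n + 1`
    (hcut : ∀ (Mq : ℕ → ℕ) (L₁ M₁ M₂ : ℕ) [NeZero L₁] [NeZero M₁] [NeZero M₂], L ≤ L₁ → (klEngQ5 P R).M0 β L₁ ≤ M₁ → Mq L₁ ≤ M₁ → M₁ ≤ M₂ →
      (∀ j < n + 1, histV15 L₁ M₁ klEngGeo5 P (klEngQ5 P R) R β U μ K j ∧
        TwoLegCoreTD L₁ M₁ (histV15 L₁ M₁ klEngGeo5 P (klEngQ5 P R) R β U μ) klEngGeo5 P (klEngQ5 P R) R β U μ K j ∧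
          TwoLegSizesMSTQ L₁ M₁ klEngGeo5 (klEngQ5 P R) R β U μ K j) →
      (∀ j < n + 1, histV15 L₁ M₂ klEngGeo5 P (klEngQ5 P R) R β U μ K j ∧
        TwoLegCoreTD L₁ M₂ (histV15 L₁ M₂ klEngGeo5 P (klEngQ5 P R) R β U μ) klEngGeo5 P (klEngQ5 P R) R β U μ K j ∧
          TwoLegSizesMSTQ L₁ M₂ klEngGeo5 (klEngQ5 P R) R β U μ K j) →
        ∀ θ : ℝ, |klLocalPart L₁ M₁ β U μ K (n + 1) θ - klLocalPart L₁ M₂ β U μ K (n + 1) θ| ≤ (klEngQ5 P R).CL β (n + 1) / 4 / L₁)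
    (hsp : ∀ (Mq : ℕ → ℕ) (L₁ L₂ M₂ : ℕ) [NeZero L₁] [NeZero L₂] [NeZero M₂], L ≤ L₁ → L₁ ∣ L₂ → (klEngQ5 P R).M0 β L₁ ≤ M₂ → Mq L₁ ≤ M₂ →
      (klEngQ5 P R).M0 β L₂ ≤ M₂ → Mq L₂ ≤ M₂ →
      (∀ j < n + 1, histV15 L₁ M₂ klEngGeo5 P (klEngQ5 P R) R β U μ K j ∧
        TwoLegCoreTD L₁ M₂ (histV15 L₁ M₂ klEngGeo5 P (klEngQ5 P R) R β U μ) klEngGeo5 P (klEngQ5 P R) R β U μ K j ∧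
          TwoLegSizesMSTQ L₁ M₂ klEngGeo5 (klEngQ5 P R) R β U μ K j) →
      (∀ j < n + 1, histV15 L₂ M₂ klEngGeo5 P (klEngQ5 P R) R β U μ K j ∧
        TwoLegCoreTD L₂ M₂ (histV15 L₂ M₂ klEngGeo5 P (klEngQ5 P R) R β U μ) klEngGeo5 P (klEngQ5 P R) R β U μ K j ∧
          TwoLegSizesMSTQ L₂ M₂ klEngGeo5 (klEngQ5 P R) R β U μ K j) →
        ∀ θ : ℝ, |klLocalPart L₁ M₂ β U μ K (n + 1) θ - klLocalPart L₂ M₂ β U μ K (n + 1) θ| ≤ (klEngQ5 P R).CL β (n + 1) / 4 / L₁) :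
    TwoLegStepV16 L M klEngGeo5 P (klEngQ5 P R) R β U μ K (n + 1) := by
  have _ := hP; have _ := hn; have _ := hreg; have _ := hhist; have _ := hE; have _ := hM
  have hcore : TwoLegCoreTD L M (histV15 L M klEngGeo5 P (klEngQ5 P R) R β U μ) klEngGeo5 P (klEngQ5 P R) R β U μ K (n + 1) :=
    twoLegCoreTD_succ_of_profileData_stub8 (L := L) (M := M) P hR hc hc3 hU hUle hβ hβc hμ hK hL
      (histV15 L M klEngGeo5 P (klEngQ5 P R) R β U μ) n hA0 hA1 hA2 hfitS hd hnear hvK' hfitL hfar hz hm₁' hfit1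
  exact twoLegStepV16_of_namedCores_stub hcore hms hcut hsp

/-! ## §2 The door keyed on the stub-6 predicate `TwoLegCurveJetBound` (plan g15 (R24): «C4a VISIBLE») -/

/-- **THE ASSEMBLY DOOR OF `stub_twoLeg_step` AT SCALE `n + 1`, JETS FROM STUB 6** — as `twoLegStepV16_succ_of_profileData_stub` with the three angular jets
DISCHARGED from `hJ : TwoLegCurveJetBound L M cc cc' β U μ K (n+1)` (`A k := curveJetBar cc cc' U k (n+1)`; at `cc := G.S`, `cc' := Q.S'` this is the
registered-form predicate `TwoLegCurveJetBoundGQ`, whose bars ARE `twoLegBar G Q U k (n+1)` — the fit `hfitS` then fixes which smaller constants the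
registrant must bake into stub 6, p2 g10 KL STATUS 09:27:17Z).  Residuals: `hfitS` (on the bars), (E3c) `hd/hnear/hvK'/hfitL/hfar`, (E3e)
`hz/hm₁'/hfit1`, (B) by name, (C) the nested legs. -/
theorem twoLegStepV16_succ_of_curveJets_stub (P : SplitConsts) (R : RenConsts) (c : ℝ) (hP : P.WF) (hR : R.WF2) (hc : 0 < c)
    (hc3 : c ≤ klEngC₃3 P R) (μ : ℝ) (hμ : μ ∈ klWindowC) (U : ℝ) (hU : 0 < U) (hUle : U ≤ klEngU₀4 P R c) (β : ℝ) (hβ : klBetaMin ≤ β)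
    (hβc : β ≤ Real.exp (c / U ^ 2)) (K : TrigPolyC4v) (hK : FrameOKDeg R U (nScales β) μ K) (L M : ℕ) [NeZero L] [NeZero M]
    (hL : klEngL₃ β U ≤ L) (hM : klEngM₃ β U L ≤ M) (n : ℕ) (hn : n + 1 ≤ nScales β + 1) (hreg : IsKLRegime U c (-((n + 1 : ℕ) : ℤ)))
    (hhist : HistP klPredsV16 L M klEngGeo5 P (klEngQ5 P R) R β U μ K (n + 1))
    (hE : EngineBoundsAtV10S L M klEngGeo5 P (klEngQ5 P R) β U μ K (n + 1))
    -- (A) stub 6's conclusion at scale `n + 1` (parametric constants) and the fits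
    {cc cc' : ℕ → ℝ} (hJ : TwoLegCurveJetBound L M cc cc' β U μ K (n + 1))
    (hfitS : ∀ j ≤ 2, (if j = 0 then curveJetBar cc cc' U 0 (n + 1) else 0) +
      (j.factorial : ℝ) ^ 2 * (2 * j.factorial * 1110 * 200 ^ j) *
        (if j = 0 then 2 * curveJetBar cc cc' U 0 (n + 1) else
          (2 * π + 1) * curveJetBar cc cc' U 1 (n + 1) + (if j = 2 then curveJetBar cc cc' U 2 (n + 1) else 0)) *
        (4 + max 1 (((j - 1).factorial : ℝ) / (8 / 5))) ^ j ≤ twoLegBar klEngGeo5 (klEngQ5 P R) U j (n + 1))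
    {d ρ : ℝ} (hd : 0 < d)
    (hnear : ∀ K' : TrigPolyC4v, FrameOKDeg R U (klTempScaleIdx β klE0) μ K' →
      (∀ j < n + 1, histV15 L M klEngGeo5 P (klEngQ5 P R) R β U μ K' j) → frameDist K K' ≤ d → ∀ θ : ℝ,
      |(klLocalPart L M β U μ K (n + 1) θ - klLocalPart L M β U μ K n θ) -
        (klLocalPart L M β U μ K' (n + 1) θ - klLocalPart L M β U μ K' n θ)| ≤ ρ * frameDist K K')
    (hvK' : ∀ K' : TrigPolyC4v, FrameOKDeg R U (klTempScaleIdx β klE0) μ K' →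
      (∀ j < n + 1, histV15 L M klEngGeo5 P (klEngQ5 P R) R β U μ K' j) → ∀ θ : ℝ,
      |klLocalPart L M β U μ K' (n + 1) θ - klLocalPart L M β U μ K' n θ| ≤ curveJetBar cc cc' U 0 (n + 1))
    (hfitL : ρ ≤ lipBar klEngGeo5 (klEngQ5 P R) U (n + 1)) (hfar : 2 * curveJetBar cc cc' U 0 (n + 1) ≤ lipBar klEngGeo5 (klEngQ5 P R) U (n + 1) * d)
    (hz : ∀ k ∈ klShell L μ K (n + 1), |klFieldStrength L M β U μ K (n + 1) k - 1| ≤ R.cz * |U|)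
    {m₁' : ℝ}
    (hm₁' : ∀ q : Momentum, |frameLevel μ K q| ≤ klScale klE0 (n + 1) →
      ‖fderiv ℝ (evalM (symInterp L (fun p => klLocSelfEnergyRe L M β U μ K (n + 1) p - K.eval (latticeMomentum L p)))) q‖ ≤ m₁')
    (hfit1 : m₁' + 4 / 3 * R.Gfr 1 * U ^ 2 ≤ R.cz * |U| * (cDtmin (-1.2) (-0.05) / 2))
    -- (B) the multi-slot sizes at scale `n + 1`, by name (opened in `…TwoLegStepSuccDoorMS`)
    (hms : TwoLegSizesMSTQ L M klEngGeo5 (klEngQ5 P R) R β U μ K (n + 1))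

    -- (C) the two nested-leg rates at scale `n + 1`
    (hcut : ∀ (Mq : ℕ → ℕ) (L₁ M₁ M₂ : ℕ) [NeZero L₁] [NeZero M₁] [NeZero M₂], L ≤ L₁ → (klEngQ5 P R).M0 β L₁ ≤ M₁ → Mq L₁ ≤ M₁ → M₁ ≤ M₂ →
      (∀ j < n + 1, histV15 L₁ M₁ klEngGeo5 P (klEngQ5 P R) R β U μ K j ∧
        TwoLegCoreTD L₁ M₁ (histV15 L₁ M₁ klEngGeo5 P (klEngQ5 P R) R β U μ) klEngGeo5 P (klEngQ5 P R) R β U μ K j ∧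
          TwoLegSizesMSTQ L₁ M₁ klEngGeo5 (klEngQ5 P R) R β U μ K j) →
      (∀ j < n + 1, histV15 L₁ M₂ klEngGeo5 P (klEngQ5 P R) R β U μ K j ∧
        TwoLegCoreTD L₁ M₂ (histV15 L₁ M₂ klEngGeo5 P (klEngQ5 P R) R β U μ) klEngGeo5 P (klEngQ5 P R) R β U μ K j ∧
          TwoLegSizesMSTQ L₁ M₂ klEngGeo5 (klEngQ5 P R) R β U μ K j) →
        ∀ θ : ℝ, |klLocalPart L₁ M₁ β U μ K (n + 1) θ - klLocalPart L₁ M₂ β U μ K (n + 1) θ| ≤ (klEngQ5 P R).CL β (n + 1) / 4 / L₁)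
    (hsp : ∀ (Mq : ℕ → ℕ) (L₁ L₂ M₂ : ℕ) [NeZero L₁] [NeZero L₂] [NeZero M₂], L ≤ L₁ → L₁ ∣ L₂ → (klEngQ5 P R).M0 β L₁ ≤ M₂ → Mq L₁ ≤ M₂ →
      (klEngQ5 P R).M0 β L₂ ≤ M₂ → Mq L₂ ≤ M₂ →
      (∀ j < n + 1, histV15 L₁ M₂ klEngGeo5 P (klEngQ5 P R) R β U μ K j ∧
        TwoLegCoreTD L₁ M₂ (histV15 L₁ M₂ klEngGeo5 P (klEngQ5 P R) R β U μ) klEngGeo5 P (klEngQ5 P R) R β U μ K j ∧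
          TwoLegSizesMSTQ L₁ M₂ klEngGeo5 (klEngQ5 P R) R β U μ K j) →
      (∀ j < n + 1, histV15 L₂ M₂ klEngGeo5 P (klEngQ5 P R) R β U μ K j ∧
        TwoLegCoreTD L₂ M₂ (histV15 L₂ M₂ klEngGeo5 P (klEngQ5 P R) R β U μ) klEngGeo5 P (klEngQ5 P R) R β U μ K j ∧
          TwoLegSizesMSTQ L₂ M₂ klEngGeo5 (klEngQ5 P R) R β U μ K j) →
        ∀ θ : ℝ, |klLocalPart L₁ M₂ β U μ K (n + 1) θ - klLocalPart L₂ M₂ β U μ K (n + 1) θ| ≤ (klEngQ5 P R).CL β (n + 1) / 4 / L₁) :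
    TwoLegStepV16 L M klEngGeo5 P (klEngQ5 P R) R β U μ K (n + 1) := by
  have hA0 : ∀ θ : ℝ, |klLocalPart L M β U μ K (n + 1) θ - klLocalPart L M β U μ K n θ| ≤ curveJetBar cc cc' U 0 (n + 1) := fun θ => by
    simpa only [klTwoLegCurveProfile_succ] using hJ.abs_le θ
  have hA1 : ∀ θ : ℝ, |deriv (fun θ => klLocalPart L M β U μ K (n + 1) θ - klLocalPart L M β U μ K n θ) θ| ≤
      curveJetBar cc cc' U 1 (n + 1) := fun θ => by
    simpa only [iteratedDeriv_one, klTwoLegCurveProfile_succ] using hJ.le (k := 1) (by norm_num) θ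
  have hA2 : ∀ θ : ℝ, |iteratedDeriv 2 (fun θ => klLocalPart L M β U μ K (n + 1) θ - klLocalPart L M β U μ K n θ) θ| ≤
      curveJetBar cc cc' U 2 (n + 1) := fun θ => by
    simpa only [klTwoLegCurveProfile_succ] using hJ.le (k := 2) (by norm_num) θ
  exact twoLegStepV16_succ_of_profileData_stub P R c hP hR hc hc3 μ hμ U hU hUle β hβ hβc K hK L M hL hM n hn hreg hhist hE
    (A := fun k => curveJetBar cc cc' U k (n + 1)) hA0 hA1 hA2 hfitS hd hnear hvK' hfitL hfar hz hm₁' hfit1 hms hcut hsp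

/-! ## §3 (appended 2026-08-27, r2d-p1 g4) The jets-to-sizes fit with DIVIDED constants and the (e)-door keyed on it — (E3a) fully discharged

With `A k := curveJetBar (G.S/X) (Q.S'/X) U k n = twoLegBar G Q U k n / X k`, p1b's chain-rule fit `hfitS` (numerals `4441`, `2.22·10⁶·(2π+1)`,
`1.776·10¹⁰`) closes as soon as `X 0 ≥ 4441`, `X 1 ≥ 2.6·10¹¹`, `X 2 ≥ 3.6·10¹⁰` (and `S 1 ≤ S 2`, `S' 1 ≤ S' 2`); at the GQ constants (`X = 1`) it cannot (KL STATUS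
2026-08-27T09:40:47Z).  Hence the consistent keying of stub 6 for the (e)/(M) feed is the divided one. -/

/-- With divided constants the jet bar IS the slot bar divided: `curveJetBar (G.S/X) (Q.S'/X) U k n = twoLegBar G Q U k n / X k`. -/
theorem curveJetBar_div_eq_twoLegBar_div (G : GeoConsts) (Q : EngConsts) (X : ℕ → ℝ) (U : ℝ) (k n : ℕ) :
    curveJetBar (fun k => G.S k / X k) (fun k => Q.S' k / X k) U k n = twoLegBar G Q U k n / X k := by
  simp only [curveJetBar, twoLegBar]
  ring

/-- The slot bars are nonnegative for nonnegative size fields. -/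
theorem twoLegBar_nonneg_of {G : GeoConsts} {Q : EngConsts} (hS : ∀ k, 0 ≤ G.S k) (hS' : ∀ k, 0 ≤ Q.S' k) (U : ℝ) (j n : ℕ) :
    0 ≤ twoLegBar G Q U j n := by
  unfold twoLegBar
  have h1 : 0 ≤ G.S j + Q.S' j * |U| := add_nonneg (hS j) (mul_nonneg (hS' j) (abs_nonneg U))
  exact mul_nonneg (mul_nonneg h1 (uPow_nonneg j U)) (zpow_nonneg (by norm_num) _)

/-- Order `1` is below order `2` when the size fields are monotone there: `twoLegBar … 1 n ≤ twoLegBar … 2 n` (`4^{−n} ≤ 1`). -/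
theorem twoLegBar_one_le_two {G : GeoConsts} {Q : EngConsts} (hS : ∀ k, 0 ≤ G.S k) (hS' : ∀ k, 0 ≤ Q.S' k)
    (hS12 : G.S 1 ≤ G.S 2) (hS'12 : Q.S' 1 ≤ Q.S' 2) (U : ℝ) (n : ℕ) : twoLegBar G Q U 1 n ≤ twoLegBar G Q U 2 n := by
  unfold twoLegBar
  have h1 : 0 ≤ G.S 1 + Q.S' 1 * |U| := add_nonneg (hS 1) (mul_nonneg (hS' 1) (abs_nonneg U))
  have h12 : G.S 1 + Q.S' 1 * |U| ≤ G.S 2 + Q.S' 2 * |U| := add_le_add hS12 (mul_le_mul_of_nonneg_right hS'12 (abs_nonneg U))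
  have hu : uPow 1 U = uPow 2 U := by simp [uPow_succ]
  have hz1 : (4 : ℝ) ^ ((((1 : ℕ) : ℤ) - 2) * (n : ℤ)) ≤ 1 := by
    have : (((1 : ℕ) : ℤ) - 2) * (n : ℤ) = -(n : ℤ) := by push_cast; ring
    rw [this, zpow_neg, zpow_natCast]
    exact inv_le_one_of_one_le₀ (one_le_pow₀ (by norm_num))
  have hz2 : (4 : ℝ) ^ ((((2 : ℕ) : ℤ) - 2) * (n : ℤ)) = 1 := by
    have : (((2 : ℕ) : ℤ) - 2) * (n : ℤ) = 0 := by push_cast; ring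
    rw [this, zpow_zero]
  rw [hu, hz2, mul_one]
  calc (G.S 1 + Q.S' 1 * |U|) * uPow 2 U * (4 : ℝ) ^ ((((1 : ℕ) : ℤ) - 2) * (n : ℤ))
      ≤ (G.S 1 + Q.S' 1 * |U|) * uPow 2 U * 1 :=
        mul_le_mul_of_nonneg_left hz1 (mul_nonneg h1 (uPow_nonneg 2 U))
    _ ≤ (G.S 2 + Q.S' 2 * |U|) * uPow 2 U := by
        rw [mul_one]; exact mul_le_mul_of_nonneg_right h12 (uPow_nonneg 2 U)

/-- **THE JETS-TO-SIZES FIT WITH DIVIDED CONSTANTS.**  If stub 6 is keyed `TwoLegCurveJetBound L M (G.S/X) (Q.S'/X) …` with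
`X 0 ≥ 4441`, `X 1 ≥ 2.6·10¹¹`, `X 2 ≥ 3.6·10¹⁰` (and `S 1 ≤ S 2`, `S' 1 ≤ S' 2`), then p1b's fit `hfitS` (j ≤ 2) of the profile closer holds for
`A k := curveJetBar (G.S/X) (Q.S'/X) U k n` — the chain-rule numerals `(j!)²·(2·j!·1110·200ʲ)·(4 + max 1 ((j−1)!/(8/5)))ʲ` of
`norm_iteratedFDeriv_onM_piece_le_of_angularJets` are absorbed by `X`. -/
theorem profileFit_of_curveJetBar_div {G : GeoConsts} {Q : EngConsts} (hS : ∀ k, 0 ≤ G.S k) (hS' : ∀ k, 0 ≤ Q.S' k)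
    (hS12 : G.S 1 ≤ G.S 2) (hS'12 : Q.S' 1 ≤ Q.S' 2) {X : ℕ → ℝ} (hX0 : 4441 ≤ X 0) (hX1 : 2.6e11 ≤ X 1) (hX2 : 3.6e10 ≤ X 2)
    (U : ℝ) (n : ℕ) :
    ∀ j ≤ 2, (if j = 0 then curveJetBar (fun k => G.S k / X k) (fun k => Q.S' k / X k) U 0 n else 0) +
      (j.factorial : ℝ) ^ 2 * (2 * j.factorial * 1110 * 200 ^ j) *
        (if j = 0 then 2 * curveJetBar (fun k => G.S k / X k) (fun k => Q.S' k / X k) U 0 n else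
          (2 * π + 1) * curveJetBar (fun k => G.S k / X k) (fun k => Q.S' k / X k) U 1 n +
            (if j = 2 then curveJetBar (fun k => G.S k / X k) (fun k => Q.S' k / X k) U 2 n else 0)) *
        (4 + max 1 (((j - 1).factorial : ℝ) / (8 / 5))) ^ j ≤ twoLegBar G Q U j n := by
  have hπ : π < 3.15 := Real.pi_lt_d2
  have hπ0 : 0 < π := Real.pi_pos
  have hB : ∀ j, 0 ≤ twoLegBar G Q U j n := fun j => twoLegBar_nonneg_of hS hS' U j n
  have hX0p : 0 < X 0 := by linarith
  have hX1p : 0 < X 1 := by linarith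
  have hX2p : 0 < X 2 := by linarith
  simp only [curveJetBar_div_eq_twoLegBar_div]
  -- the divided bars `y k := B k / X k`: `y k * X k = B k`, `0 ≤ y k`
  set y0 : ℝ := twoLegBar G Q U 0 n / X 0 with hy0d
  set y1 : ℝ := twoLegBar G Q U 1 n / X 1 with hy1d
  set y2 : ℝ := twoLegBar G Q U 2 n / X 2 with hy2d
  have hy0 : y0 * X 0 = twoLegBar G Q U 0 n := div_mul_cancel₀ _ hX0p.ne'
  have hy1 : y1 * X 1 = twoLegBar G Q U 1 n := div_mul_cancel₀ _ hX1p.ne'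
  have hy2 : y2 * X 2 = twoLegBar G Q U 2 n := div_mul_cancel₀ _ hX2p.ne'
  have hy0n : 0 ≤ y0 := div_nonneg (hB 0) hX0p.le
  have hy1n : 0 ≤ y1 := div_nonneg (hB 1) hX1p.le
  have hy2n : 0 ≤ y2 := div_nonneg (hB 2) hX2p.le
  have h12 := twoLegBar_one_le_two hS hS' hS12 hS'12 U n
  intro j hj
  interval_cases j
  · -- j = 0 : (1 + 4440)·y0 ≤ y0·X0
    simp only [if_true, Nat.factorial_zero, Nat.cast_one, one_pow, mul_one, pow_zero, one_mul]
    nlinarith [mul_le_mul_of_nonneg_left hX0 hy0n]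
  · -- j = 1 : 2.22e6·(2π+1)·y1 ≤ y1·X1
    have hmax : max (1 : ℝ) (((1 - 1 : ℕ).factorial : ℝ) / (8 / 5)) = 1 := by norm_num
    simp only [one_ne_zero, if_false, Nat.factorial_one, Nat.cast_one, one_pow, one_mul, pow_one, zero_add,
      show ¬ ((1 : ℕ) = 2) from by norm_num, add_zero, hmax]
    nlinarith [mul_le_mul_of_nonneg_left hX1 hy1n, mul_nonneg hy1n hπ0.le]
  · -- j = 2 : 1.776e10·((2π+1)·y1 + y2) ≤ B2, with B1 ≤ B2
    have hmax : max (1 : ℝ) (((2 - 1 : ℕ).factorial : ℝ) / (8 / 5)) = 1 := by norm_num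
    simp only [show ¬ ((2 : ℕ) = 0) from by norm_num, if_false, if_true, Nat.factorial_two, Nat.cast_ofNat, zero_add, hmax]
    nlinarith [mul_le_mul_of_nonneg_left hX1 hy1n, mul_le_mul_of_nonneg_left hX2 hy2n, mul_nonneg hy1n hπ0.le,
      mul_nonneg hy2n hπ0.le]

/-- **THE (e)-DOOR AT `n + 1` KEYED ON STUB 6 WITH DIVIDED CONSTANTS — (E3a) FULLY DISCHARGED.**  If the registered stub 6 concludes
`TwoLegCurveJetBound L M (fun k => klEngGeo5.S k / X k) (fun k => (klEngQ5 P R).S' k / X k) β U μ K (n+1)` for a table `X` with `X 0 ≥ 4441`,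
`X 1 ≥ 2.6·10¹¹`, `X 2 ≥ 3.6·10¹⁰`, then under (e)'s literal binders the slot `TwoLegStepV16 … (n+1)` follows from that conclusion, the (E3c) rows
(`hd/hnear/hvK'/hfitL/hfar`), the (E3e) rows (`hz/hm₁'/hfit1`), (B) by name and (C) the nested legs — NO fit hypothesis on the jets is left
(`profileFit_of_curveJetBar_div`). -/
theorem twoLegStepV16_succ_of_curveJetsDiv_stub (P : SplitConsts) (R : RenConsts) (c : ℝ) (hP : P.WF) (hR : R.WF2) (hc : 0 < c)
    (hc3 : c ≤ klEngC₃3 P R) (μ : ℝ) (hμ : μ ∈ klWindowC) (U : ℝ) (hU : 0 < U) (hUle : U ≤ klEngU₀4 P R c) (β : ℝ) (hβ : klBetaMin ≤ β)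
    (hβc : β ≤ Real.exp (c / U ^ 2)) (K : TrigPolyC4v) (hK : FrameOKDeg R U (nScales β) μ K) (L M : ℕ) [NeZero L] [NeZero M]
    (hL : klEngL₃ β U ≤ L) (hM : klEngM₃ β U L ≤ M) (n : ℕ) (hn : n + 1 ≤ nScales β + 1) (hreg : IsKLRegime U c (-((n + 1 : ℕ) : ℤ)))
    (hhist : HistP klPredsV16 L M klEngGeo5 P (klEngQ5 P R) R β U μ K (n + 1))
    (hE : EngineBoundsAtV10S L M klEngGeo5 P (klEngQ5 P R) β U μ K (n + 1))
    -- (A) stub 6's conclusion at scale `n + 1`, divided constants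
    {X : ℕ → ℝ} (hX0 : 4441 ≤ X 0) (hX1 : 2.6e11 ≤ X 1) (hX2 : 3.6e10 ≤ X 2)
    (hJ : TwoLegCurveJetBound L M (fun k => klEngGeo5.S k / X k) (fun k => (klEngQ5 P R).S' k / X k) β U μ K (n + 1))
    {d ρ : ℝ} (hd : 0 < d)
    (hnear : ∀ K' : TrigPolyC4v, FrameOKDeg R U (klTempScaleIdx β klE0) μ K' →
      (∀ j < n + 1, histV15 L M klEngGeo5 P (klEngQ5 P R) R β U μ K' j) → frameDist K K' ≤ d → ∀ θ : ℝ,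
      |(klLocalPart L M β U μ K (n + 1) θ - klLocalPart L M β U μ K n θ) -
        (klLocalPart L M β U μ K' (n + 1) θ - klLocalPart L M β U μ K' n θ)| ≤ ρ * frameDist K K')
    (hvK' : ∀ K' : TrigPolyC4v, FrameOKDeg R U (klTempScaleIdx β klE0) μ K' →
      (∀ j < n + 1, histV15 L M klEngGeo5 P (klEngQ5 P R) R β U μ K' j) → ∀ θ : ℝ,
      |klLocalPart L M β U μ K' (n + 1) θ - klLocalPart L M β U μ K' n θ| ≤ curveJetBar (fun k => klEngGeo5.S k / X k) (fun k => (klEngQ5 P R).S' k / X k) U 0 (n + 1))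
    (hfitL : ρ ≤ lipBar klEngGeo5 (klEngQ5 P R) U (n + 1)) (hfar : 2 * curveJetBar (fun k => klEngGeo5.S k / X k) (fun k => (klEngQ5 P R).S' k / X k) U 0 (n + 1) ≤ lipBar klEngGeo5 (klEngQ5 P R) U (n + 1) * d)
    (hz : ∀ k ∈ klShell L μ K (n + 1), |klFieldStrength L M β U μ K (n + 1) k - 1| ≤ R.cz * |U|)
    {m₁' : ℝ}
    (hm₁' : ∀ q : Momentum, |frameLevel μ K q| ≤ klScale klE0 (n + 1) →
      ‖fderiv ℝ (evalM (symInterp L (fun p => klLocSelfEnergyRe L M β U μ K (n + 1) p - K.eval (latticeMomentum L p)))) q‖ ≤ m₁')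
    (hfit1 : m₁' + 4 / 3 * R.Gfr 1 * U ^ 2 ≤ R.cz * |U| * (cDtmin (-1.2) (-0.05) / 2))
    -- (B) the multi-slot sizes at scale `n + 1`, by name (opened in `…TwoLegStepSuccDoorMS`)
    (hms : TwoLegSizesMSTQ L M klEngGeo5 (klEngQ5 P R) R β U μ K (n + 1))

    -- (C) the two nested-leg rates at scale `n + 1`
    (hcut : ∀ (Mq : ℕ → ℕ) (L₁ M₁ M₂ : ℕ) [NeZero L₁] [NeZero M₁] [NeZero M₂], L ≤ L₁ → (klEngQ5 P R).M0 β L₁ ≤ M₁ → Mq L₁ ≤ M₁ → M₁ ≤ M₂ →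
      (∀ j < n + 1, histV15 L₁ M₁ klEngGeo5 P (klEngQ5 P R) R β U μ K j ∧
        TwoLegCoreTD L₁ M₁ (histV15 L₁ M₁ klEngGeo5 P (klEngQ5 P R) R β U μ) klEngGeo5 P (klEngQ5 P R) R β U μ K j ∧
          TwoLegSizesMSTQ L₁ M₁ klEngGeo5 (klEngQ5 P R) R β U μ K j) →
      (∀ j < n + 1, histV15 L₁ M₂ klEngGeo5 P (klEngQ5 P R) R β U μ K j ∧
        TwoLegCoreTD L₁ M₂ (histV15 L₁ M₂ klEngGeo5 P (klEngQ5 P R) R β U μ) klEngGeo5 P (klEngQ5 P R) R β U μ K j ∧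
          TwoLegSizesMSTQ L₁ M₂ klEngGeo5 (klEngQ5 P R) R β U μ K j) →
        ∀ θ : ℝ, |klLocalPart L₁ M₁ β U μ K (n + 1) θ - klLocalPart L₁ M₂ β U μ K (n + 1) θ| ≤ (klEngQ5 P R).CL β (n + 1) / 4 / L₁)
    (hsp : ∀ (Mq : ℕ → ℕ) (L₁ L₂ M₂ : ℕ) [NeZero L₁] [NeZero L₂] [NeZero M₂], L ≤ L₁ → L₁ ∣ L₂ → (klEngQ5 P R).M0 β L₁ ≤ M₂ → Mq L₁ ≤ M₂ →
      (klEngQ5 P R).M0 β L₂ ≤ M₂ → Mq L₂ ≤ M₂ →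
      (∀ j < n + 1, histV15 L₁ M₂ klEngGeo5 P (klEngQ5 P R) R β U μ K j ∧
        TwoLegCoreTD L₁ M₂ (histV15 L₁ M₂ klEngGeo5 P (klEngQ5 P R) R β U μ) klEngGeo5 P (klEngQ5 P R) R β U μ K j ∧
          TwoLegSizesMSTQ L₁ M₂ klEngGeo5 (klEngQ5 P R) R β U μ K j) →
      (∀ j < n + 1, histV15 L₂ M₂ klEngGeo5 P (klEngQ5 P R) R β U μ K j ∧
        TwoLegCoreTD L₂ M₂ (histV15 L₂ M₂ klEngGeo5 P (klEngQ5 P R) R β U μ) klEngGeo5 P (klEngQ5 P R) R β U μ K j ∧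
          TwoLegSizesMSTQ L₂ M₂ klEngGeo5 (klEngQ5 P R) R β U μ K j) →
        ∀ θ : ℝ, |klLocalPart L₁ M₂ β U μ K (n + 1) θ - klLocalPart L₂ M₂ β U μ K (n + 1) θ| ≤ (klEngQ5 P R).CL β (n + 1) / 4 / L₁) :
    TwoLegStepV16 L M klEngGeo5 P (klEngQ5 P R) R β U μ K (n + 1) :=
  twoLegStepV16_succ_of_curveJets_stub P R c hP hR hc hc3 μ hμ U hU hUle β hβ hβc K hK L M hL hM n hn hreg hhist hE hJ
    (profileFit_of_curveJetBar_div (G := klEngGeo5) (Q := klEngQ5 P R) (fun _ => by show (0 : ℝ) ≤ 2 ^ 10; positivity)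
      (klEngQ5_wf P R).2.2.2.2.1 le_rfl le_rfl hX0 hX1 hX2 U (n + 1))
    hd hnear hvK' hfitL hfar hz hm₁' hfit1 hms hcut hsp

end Summit.HubbardSuperconductivity.HubbardSuperconductivity.Theorems.EngineV8

end
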